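import Summits.ABC.IUTFork.Cor312UnitShells
import HarnessLib

/-!
# IUT REPAIR branch (rung LADDER-ABC:A2.RP) — the SCALAR SHELLS: one `p`-adic toy packet model for every scalar indeterminacy group

MODEL DATA (toy definitions + folklore lemmas; no `Prop` fact, nothing asserted about print) of the abc-iut cell's IUT REPAIR branch,
by abc-iut-w4-d098 (gen 3), ONE BUILDER per abc-iut-rp-plan RULINGS #11 (1) 2026-08-26T06:55Z, on abc-iut-w5-d147's design
(STATUS 06:40:10Z): «type the new shells over a SCALAR SET … `scalarShells U` with ism v = stripAut v = {x ↦ s·x | s ∈ U}; then the closure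
lemma is ONE induction, and U = {±1} recovers the sign shells, U = units the unit shells, U ∋ p the door-(b) SCALING model». TAKES NO SIDE
on [IUTchIII] Cor. 3.12 or on any author; toys of the typed interface over abc-iut-c312-7's one-place `toyIndex` (`l⋇ = 2`).

CONTENT. For a subgroup `U ≤ ℚˣ` of nonzero rational SCALARS:
* §1 `scalarAuts U` — the automorphisms `y ↦ u·y`, `u ∈ U`, of the line `ℚ`; `scalarShells p U : LogShells toyIndex` — carrier `ℚ`, log-shell
  the `p`-adic unit ball, strip-automorphisms AND "Ism" := `scalarAuts U` ([IUTchIII] Prop. 1.2 (vi)/(vii) read with a scalar group in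
  place of `{±1}`); SAME packets as abc-iut-w5-d247's `signShells` and abc-iut-w4-d101's `unitShells p` (all carriers are `ℚ`), so their
  `line`, `pBall`, `pFrame`, `pVol` apply verbatim.
* §2 `ActsByScalars U Φ` («on every packet line `Φ` is multiplication by an element of `U`») and THE CLOSURE LEMMA
  `actsByScalars_of_mem_closure`: every element of `⟨(Ind1) ∪ (Ind2)⟩` of the scalar shells acts by scalars of `U` (one induction, as in
  `UnitWitness.actsByUnits_of_mem_closure`).
* §3 BALL TRANSPORT `image_sBall_of_line_eq : line ∘ Φ = c·line ⟹ Φ(B_k) = B_{k + v_p(c)}` (balls/frame/volume `sBall`/`sFrame`/`sVol` =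
  w5-d247's `pBall`/`pFrame`/`pVol` re-typed) and its volume form `sVol (Φ '' B_k) = sVol B_k − v_p(c)·log p`; for `U` inside the `p`-adic units
  every ball is FIXED (`image_sBall_of_actsByScalars_of_units`,
  recovering abc-iut-w4-d101's `image_uBall_of_mem_closure`).
* §4 the (Ind2)-families `sFam u` («multiply by `u` on every summand of every factor»; scalar `u^{j+1}` on the packet at label `j`) and, for
  ANY `U` containing the uniformiser `p` (e.g. `U = ⊤ = ℚˣ` — the door-(b) / Joshi-rescaling model `scalingShells p := scalarShells p ⊤`):
  `exists_ind2_moving_sBall : ∃ Φ ∈ (Ind2), Φ(B_k) = B_{k+j+1}` at every label — so NO ball is stable under the indeterminacy group,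
  ball-valued Θ-regions are MOVED, and Step (x) log-volume invariance FAILS for balls (`sVol_image_sFam_pUnit`); at label `j` the family
  `sFam (p^a)` shifts `B_k ↦ B_{k + a(j+1)}`, in particular `B_{j²} ↦ B_1` is NOT reachable uniformly in `j` by ONE power of `p`, but IS
  reachable label-by-label by (Ind2)-families with label-dependent scalars (`image_sBall_sFam_zpow`).
Per-row instantiations (NOT here, per RULINGS #11): abc-iut-rp-j2 `CandJoshi22` (transported naive data + Joshi's non-isometric
indeterminacy), abc-iut-rp-s2 / abc-iut-w5-d147 door-(b) witness for RP-S02, abc-iut-rp-j1 `CandJoshi7`.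
[claim: Mochizuki2012, status: disputed]
-/

noncomputable section

namespace Summit.ABC.IUTFork.Repair.ScalarShells

open Thm311 Cor312 Cor312.Checks Cor312.IdentifiedNonVacuity Cor312Vol.NaiveWitness Cor312Vol.UnitWitness Literature.IUT.LogThetaLattice

variable (p : ℕ) (U : Subgroup ℚˣ)

/-! ## 1. Scalar automorphism groups and the scalar shells -/

/-- The automorphisms `y ↦ u·y` of the line `ℚ` for `u` in the scalar group `U ≤ ℚˣ` — the "Ism" and the strip-automorphism group of the
scalar shells. [claim: Mochizuki2012, status: disputed] -/
def scalarAuts : Set (ℚ ≃ₗ[ℚ] ℚ) := {g | ∃ u : ℚˣ, u ∈ U ∧ ∀ y : ℚ, g y = (u : ℚ) * y}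

/-- The identity is the scalar `1 ∈ U`. [folklore] -/
theorem refl_mem_scalarAuts : LinearEquiv.refl ℚ ℚ ∈ scalarAuts U := ⟨1, U.one_mem, fun y => (one_mul y).symm⟩

/-- `mulEquiv u ∈ scalarAuts U` for `u ∈ U`. [folklore] -/
theorem mulEquiv_mem_scalarAuts {u : ℚˣ} (hu : u ∈ U) : mulEquiv (u : ℚ) u.ne_zero ∈ scalarAuts U := ⟨u, hu, fun _ => rfl⟩

/-- **The SCALAR SHELLS over `U`**: `log(D⊢_v) := ℚ`, log-shell the `p`-adic unit ball, strip-automorphisms and "Ism" both `scalarAuts U`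
(an `abbrev`, so that the carrier reduces to `ℚ` and the packets ARE those of `signShells` / `unitShells p`). [claim: Mochizuki2012, status: disputed] -/
abbrev scalarShells : LogShells toyIndex where
  carrier := fun _ => ℚ
  shell := fun _ => {x | x = 0 ∨ 0 ≤ padicValRat p x}
  stripAut := fun _ => scalarAuts U
  ism := fun _ => scalarAuts U
  one_mem_stripAut := fun _ => refl_mem_scalarAuts U
  one_mem_ism := fun _ => refl_mem_scalarAuts U

/-- **The SCALING SHELLS** (door (b) / Joshi-rescaling model): ALL of `ℚˣ` as the scalar group — signs, `p`-adic units AND the powers of the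
uniformiser `p` act as indeterminacies. [claim: Mochizuki2012, status: disputed] -/
abbrev scalingShells : LogShells toyIndex := scalarShells p ⊤

/-! ## 2. Acting by scalars of `U`; the closure lemma -/

/-- A packet-automorphism family ACTS BY SCALARS OF `U`: on every packet line it is multiplication by some `u ∈ U`. [folklore] -/
structure ActsByScalars (Φ : (scalarShells p U).PacketAut) : Prop where
  /-- on every packet line `Φ` is multiplication by an element of `U` -/
  scalar : ∀ (j : toyIndex.Label) (vQ : toyIndex.VQ), ∃ u : ℚˣ, u ∈ U ∧
    ∀ x : (scalarShells p U).Packet j vQ, line j vQ (Φ j vQ x) = (u : ℚ) * line j vQ x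

variable {p U}

/-- A summand-wise `U`-scalar automorphism of the 1-packet `Fibre → ℚ` (one-point fibre) is a `U`-multiple. [folklore] -/
theorem summandwise_eq_smul (vQ : toyIndex.VQ)
    (g : ∀ v : toyIndex.Fibre vQ, (scalarShells p U).carrier v.1 ≃ₗ[ℚ] (scalarShells p U).carrier v.1)
    (hg : ∀ v, g v ∈ scalarAuts U) :
    ∃ u : ℚˣ, u ∈ U ∧ ∀ y : (scalarShells p U).Packet1 vQ, (scalarShells p U).summandwise vQ g y = (u : ℚ) • y := by
  haveI := toyFibreUnique vQ
  obtain ⟨u, hu, hgu⟩ := hg default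
  refine ⟨u, hu, fun y => ?_⟩
  funext v
  rw [Unique.eq_default v]
  exact hgu _

/-- The identity family acts by scalars. [folklore] -/
theorem actsByScalars_one : ActsByScalars p U 1 := ⟨fun j vQ => ⟨1, U.one_mem, fun x => by rw [Units.val_one, one_mul]; rfl⟩⟩

/-- A finite product of elements of `U`, computed in `ℚ`, is the coercion of the product in `ℚˣ` (which lies in `U`). [folklore] -/
theorem prod_coe_units {ι : Type} [Fintype ι] (s : ι → ℚˣ) : (∏ i, ((s i : ℚˣ) : ℚ)) = ((∏ i, s i : ℚˣ) : ℚ) := by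
  rw [Units.coe_prod]

/-- Every (Ind2)-family of the scalar shells acts by scalars of `U`. [folklore] -/
theorem actsByScalars_of_mem_Ind2Family {Φ : (scalarShells p U).PacketAut} (h : Φ ∈ (scalarShells p U).Ind2Family) :
    ActsByScalars p U Φ := by
  refine ⟨fun j vQ => ?_⟩
  obtain ⟨g, hg, hΦ⟩ := h j vQ
  have hs : ∀ i, ∃ u : ℚˣ, u ∈ U ∧
      ∀ y : (scalarShells p U).Packet1 vQ, (scalarShells p U).summandwise vQ (g i) y = (u : ℚ) • y :=
    fun i => summandwise_eq_smul vQ (g i) (hg i)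
  choose s hs1 hs2 using hs
  refine ⟨∏ i, s i, U.prod_mem fun i _ => hs1 i, fun x => ?_⟩
  rw [hΦ, ← prod_coe_units]
  exact line_factorwise_of_smul j vQ _ (fun i => (s i : ℚ)) hs2 x

/-- Every (Ind1)-family (a permutation of the capsule, `U`-scalar strip-automorphisms on every summand of every factor) acts by scalars of `U`.
[folklore] -/
theorem actsByScalars_of_mem_Ind1Family {Φ : (scalarShells p U).PacketAut} (h : Φ ∈ (scalarShells p U).Ind1Family) :
    ActsByScalars p U Φ := by
  refine ⟨fun j vQ => ?_⟩
  obtain ⟨σ, hh, hmem, hΦ⟩ := h j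
  have hs : ∀ i, ∃ u : ℚˣ, u ∈ U ∧ ∀ y : (scalarShells p U).Packet1 vQ,
      (scalarShells p U).summandwise vQ (fun v => hh i v.1) y = (u : ℚ) • y :=
    fun i => summandwise_eq_smul vQ (fun v => hh i v.1) fun v => hmem i v.1
  choose s hs1 hs2 using hs
  refine ⟨∏ i, s i, U.prod_mem fun i _ => hs1 i, fun x => ?_⟩
  have hΦ' : Φ j vQ = ((scalarShells p U).permute j vQ σ).trans
      ((scalarShells p U).factorwise j vQ fun i => (scalarShells p U).summandwise vQ fun v => hh i v.1) := hΦ vQ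
  rw [hΦ', LinearEquiv.trans_apply]
  have h1 : line j vQ (((scalarShells p U).factorwise j vQ fun i => (scalarShells p U).summandwise vQ fun v => hh i v.1)
      (((scalarShells p U).permute j vQ σ) x)) = (∏ i, (s i : ℚ)) * line j vQ (((scalarShells p U).permute j vQ σ) x) :=
    line_factorwise_of_smul j vQ _ (fun i => (s i : ℚ)) hs2 _
  have h2 : line j vQ (((scalarShells p U).permute j vQ σ) x) = line j vQ x := line_permute j vQ σ x
  rw [h1, h2, prod_coe_units]

/-- Acting by scalars is closed under composition. [folklore] -/
theorem ActsByScalars.mul {Φ Ψ : (scalarShells p U).PacketAut} (hΦ : ActsByScalars p U Φ) (hΨ : ActsByScalars p U Ψ) :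
    ActsByScalars p U (Φ * Ψ) := by
  refine ⟨fun j vQ => ?_⟩
  obtain ⟨c, hc, hΦc⟩ := hΦ.scalar j vQ
  obtain ⟨d, hd, hΨd⟩ := hΨ.scalar j vQ
  refine ⟨c * d, U.mul_mem hc hd, fun x => ?_⟩
  show line j vQ (Φ j vQ (Ψ j vQ x)) = _
  rw [hΦc, hΨd, Units.val_mul, mul_assoc]

/-- Acting by scalars is closed under inverses. [folklore] -/
theorem ActsByScalars.inv {Φ : (scalarShells p U).PacketAut} (hΦ : ActsByScalars p U Φ) : ActsByScalars p U Φ⁻¹ := by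
  refine ⟨fun j vQ => ?_⟩
  obtain ⟨c, hc, hΦc⟩ := hΦ.scalar j vQ
  refine ⟨c⁻¹, U.inv_mem hc, fun x => ?_⟩
  show line j vQ ((Φ j vQ).symm x) = _
  have h := hΦc ((Φ j vQ).symm x)
  rw [LinearEquiv.apply_symm_apply] at h
  rw [h, ← mul_assoc, Units.val_inv_eq_inv_val, inv_mul_cancel₀ c.ne_zero, one_mul]

/-- **THE CLOSURE LEMMA: every element of the group generated by (Ind1), (Ind2) of the scalar shells acts by scalars of `U`** on the packet
lines (abc-iut-w5-d147's «every Φ ∈ ⟨Ind1∪Ind2⟩ multiplies the label-`j` line by a product of elements of `U`»). [folklore] -/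
theorem actsByScalars_of_mem_closure {Φ : (scalarShells p U).PacketAut}
    (h : Φ ∈ Subgroup.closure ((scalarShells p U).Ind1Family ∪ (scalarShells p U).Ind2Family)) : ActsByScalars p U Φ := by
  induction h using Subgroup.closure_induction with
  | mem Ψ hΨ =>
    rcases hΨ with h1 | h2
    · exact actsByScalars_of_mem_Ind1Family h1
    · exact actsByScalars_of_mem_Ind2Family h2
  | one => exact actsByScalars_one
  | mul Ψ Ψ' _ _ hΨ hΨ' => exact hΨ.mul hΨ'
  | inv Ψ _ hΨ => exact hΨ.inv

/-- Two families acting by scalars COMMUTE on every packet (the packets are lines). [folklore] -/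
theorem ActsByScalars.comm {Φ Ψ : (scalarShells p U).PacketAut} (hΦ : ActsByScalars p U Φ) (hΨ : ActsByScalars p U Ψ)
    (j : toyIndex.Label) (vQ : toyIndex.VQ) (x : (scalarShells p U).Packet j vQ) :
    Φ j vQ (Ψ j vQ x) = Ψ j vQ (Φ j vQ x) := by
  obtain ⟨c, -, hc⟩ := hΦ.scalar j vQ
  obtain ⟨d, -, hd⟩ := hΨ.scalar j vQ
  apply (line j vQ).injective
  rw [hc, hd, hd, hc]
  ring

/-! ## 3. The `p`-adic balls on the scalar shells' packets; ball transport `B_k ↦ B_{k + v_p(c)}` -/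

variable (p U)

/-- The `p`-ADIC BALL `B_k` as a region of a tensor packet of the scalar shells — the same set as abc-iut-w5-d247's `pBall p j vQ k` (same
packet), re-typed so that statements over the scalar shells are homogeneous (as abc-iut-w4-d101's `uBall`). [claim: Mochizuki2012, status: disputed] -/
def sBall (j : toyIndex.Label) (vQ : toyIndex.VQ) (k : ℤ) : Set ((scalarShells p U).Packet j vQ) := pBall p j vQ k

/-- The HULL FRAME of `p`-adic balls on a packet of the scalar shells (`pFrame`, re-typed). [claim: Mochizuki2012, status: disputed] -/
def sFrame (j : toyIndex.Label) (vQ : toyIndex.VQ) : HullFrame ((scalarShells p U).Packet j vQ) := pFrame p j vQ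

/-- The LOG-VOLUME `μ(B_k) = −k·log p` on a packet of the scalar shells (`pVol`, re-typed). [claim: Mochizuki2012, status: disputed] -/
def sVol (j : toyIndex.Label) (vQ : toyIndex.VQ) (A : Set ((scalarShells p U).Packet j vQ)) : ℝ := pVol p j vQ A

/-- Membership in `B_k`: `line x = 0 ∨ v_p(line x) ≥ k`. [folklore] -/
theorem mem_sBall_iff (j : toyIndex.Label) (vQ : toyIndex.VQ) (k : ℤ) (x : (scalarShells p U).Packet j vQ) :
    x ∈ sBall p U j vQ k ↔ line j vQ x = 0 ∨ k ≤ padicValRat p (line j vQ x) := Iff.rfl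

/-- `sBall = pBall` and `sVol = pVol` as sets / functions (re-typing only). [folklore] -/
theorem sBall_eq_pBall (j : toyIndex.Label) (vQ : toyIndex.VQ) (k : ℤ) : sBall p U j vQ k = pBall p j vQ k := rfl

/-- `0 ∈ B_k`. [folklore] -/
theorem zero_mem_sBall (j : toyIndex.Label) (vQ : toyIndex.VQ) (k : ℤ) : (0 : (scalarShells p U).Packet j vQ) ∈ sBall p U j vQ k :=
  zero_mem_pBall p j vQ k

/-- The balls are nested. [folklore] -/
theorem sBall_mono (j : toyIndex.Label) (vQ : toyIndex.VQ) {k k' : ℤ} (h : k' ≤ k) : sBall p U j vQ k ⊆ sBall p U j vQ k' :=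
  pBall_mono p j vQ h

section Balls

variable [hp : Fact p.Prime]

/-- `k ↦ B_k` is injective. [folklore] -/
theorem sBall_injective (j : toyIndex.Label) (vQ : toyIndex.VQ) : Function.Injective (sBall p U j vQ) := pBall_injective p j vQ

/-- `B_k ⊆ B_{k'} ↔ k' ≤ k`. [folklore] -/
theorem sBall_subset_iff (j : toyIndex.Label) (vQ : toyIndex.VQ) (k k' : ℤ) : sBall p U j vQ k ⊆ sBall p U j vQ k' ↔ k' ≤ k :=
  pBall_subset_iff p j vQ k k'

/-- Balls are hull-sets; the hull of a ball is itself; a ball is bounded and admits its hull. [folklore] -/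
theorem sBall_mem_hul (j : toyIndex.Label) (vQ : toyIndex.VQ) (k : ℤ) :
    sBall p U j vQ k ∈ (sFrame p U j vQ).Hul ∧ (sFrame p U j vQ).hull (sBall p U j vQ k) = sBall p U j vQ k ∧
      (sFrame p U j vQ).IsBounded (sBall p U j vQ k) ∧ (sFrame p U j vQ).HasHull (sBall p U j vQ k) :=
  ⟨⟨k, rfl⟩, pFrame_hull_pBall p j vQ k, pFrame_bounded_hasHull p j vQ k⟩

/-- `μ(B_k) = −k·log p`. [folklore] -/
theorem sVol_sBall (j : toyIndex.Label) (vQ : toyIndex.VQ) (k : ℤ) : sVol p U j vQ (sBall p U j vQ k) = -(k : ℝ) * Real.log p :=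
  pVol_pBall p j vQ k

variable {p U}

/-- **BALL TRANSPORT**: a packet automorphism acting on the line by the scalar `c ≠ 0` maps `B_k` ONTO `B_{k + v_p(c)}`. [folklore] -/
theorem image_sBall_of_line_eq {j : toyIndex.Label} {vQ : toyIndex.VQ}
    (Φ : (scalarShells p U).Packet j vQ ≃ₗ[ℚ] (scalarShells p U).Packet j vQ)
    {c : ℚ} (hc : c ≠ 0) (hΦ : ∀ x, line j vQ (Φ x) = c * line j vQ x) (k : ℤ) :
    Φ '' sBall p U j vQ k = sBall p U j vQ (k + padicValRat p c) := by
  apply Set.Subset.antisymm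
  · rintro _ ⟨x, hx, rfl⟩
    rw [mem_sBall_iff, hΦ]
    rcases hx with hx | hx
    · exact Or.inl (by rw [hx, mul_zero])
    · by_cases h0 : line j vQ x = 0
      · exact Or.inl (by rw [h0, mul_zero])
      · right; rw [padicValRat.mul hc h0]; linarith
  · intro y hy
    refine ⟨Φ.symm y, ?_, LinearEquiv.apply_symm_apply _ _⟩
    have h1 := hΦ (Φ.symm y)
    rw [LinearEquiv.apply_symm_apply] at h1
    have h2 : line j vQ (Φ.symm y) = c⁻¹ * line j vQ y := by
      rw [h1, ← mul_assoc, inv_mul_cancel₀ hc, one_mul]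
    rw [mem_sBall_iff, h2]
    rcases hy with hy | hy
    · exact Or.inl (by rw [hy, mul_zero])
    · by_cases h0 : line j vQ y = 0
      · exact Or.inl (by rw [h0, mul_zero])
      · right
        rw [padicValRat.mul (inv_ne_zero hc) h0, padicValRat.inv]
        linarith

/-- Volume form of ball transport: `μ(Φ(B_k)) = μ(B_k) − v_p(c)·log p`. [folklore] -/
theorem sVol_image_sBall_of_line_eq {j : toyIndex.Label} {vQ : toyIndex.VQ}
    (Φ : (scalarShells p U).Packet j vQ ≃ₗ[ℚ] (scalarShells p U).Packet j vQ)
    {c : ℚ} (hc : c ≠ 0) (hΦ : ∀ x, line j vQ (Φ x) = c * line j vQ x) (k : ℤ) :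
    sVol p U j vQ (Φ '' sBall p U j vQ k) = sVol p U j vQ (sBall p U j vQ k) - (padicValRat p c : ℝ) * Real.log p := by
  rw [image_sBall_of_line_eq Φ hc hΦ, sVol_sBall, sVol_sBall]
  push_cast
  ring

/-- A family acting by scalars of `U` maps every ball onto a ball, shifted by the valuation of its scalar at that packet. [folklore] -/
theorem image_sBall_of_actsByScalars {Φ : (scalarShells p U).PacketAut} (h : ActsByScalars p U Φ) (j : toyIndex.Label)
    (vQ : toyIndex.VQ) (k : ℤ) : ∃ u : ℚˣ, u ∈ U ∧ Φ j vQ '' sBall p U j vQ k = sBall p U j vQ (k + padicValRat p (u : ℚ)) := by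
  obtain ⟨u, hu, hΦ⟩ := h.scalar j vQ
  exact ⟨u, hu, image_sBall_of_line_eq (Φ j vQ) u.ne_zero hΦ k⟩

/-- **ISOMETRIC CASE**: if every scalar of `U` is a `p`-adic unit (`v_p = 0`), families acting by scalars FIX every ball — abc-iut-w4-d101's
`image_uBall_of_mem_closure` and abc-iut-w5-d247's `image_pBall_of_mem_closure` are the instances `U = units`, `U = {±1}`. [folklore] -/
theorem image_sBall_of_actsByScalars_of_units (hU : ∀ u : ℚˣ, u ∈ U → padicValRat p (u : ℚ) = 0)
    {Φ : (scalarShells p U).PacketAut} (h : ActsByScalars p U Φ) (j : toyIndex.Label) (vQ : toyIndex.VQ) (k : ℤ) :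
    Φ j vQ '' sBall p U j vQ k = sBall p U j vQ k := by
  obtain ⟨u, hu, himg⟩ := image_sBall_of_actsByScalars h j vQ k
  rw [himg, hU u hu, add_zero]

end Balls

/-! ## 4. The (Ind2)-families `sFam u`; scalar groups containing the uniformiser MOVE every ball -/

/-- **The (Ind2)-family «multiply by `u` on every summand of every factor»** of the scalar shells (`u ∈ ℚˣ`). [claim: Mochizuki2012, status: disputed] -/
def sFam (u : ℚˣ) : (scalarShells p U).PacketAut := fun j vQ =>
  (scalarShells p U).factorwise j vQ fun _ => (scalarShells p U).summandwise vQ fun _ => mulEquiv (u : ℚ) u.ne_zero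

/-- For `u ∈ U`, `sFam u` is an (Ind2)-family of the scalar shells. [folklore] -/
theorem sFam_mem_Ind2Family {u : ℚˣ} (hu : u ∈ U) : sFam p U u ∈ (scalarShells p U).Ind2Family := fun _ _ =>
  ⟨fun _ _ => mulEquiv (u : ℚ) u.ne_zero, fun _ _ => mulEquiv_mem_scalarAuts U hu, rfl⟩

/-- … hence an element of `⟨(Ind1) ∪ (Ind2)⟩`. [folklore] -/
theorem sFam_mem_closure {u : ℚˣ} (hu : u ∈ U) :
    sFam p U u ∈ Subgroup.closure ((scalarShells p U).Ind1Family ∪ (scalarShells p U).Ind2Family) :=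
  Subgroup.subset_closure (Or.inr (sFam_mem_Ind2Family p U hu))

/-- `sFam u` is the scalar `u^{#S^±_{j+1}} = u^{j+1}` on the packet at label `j` (multilinearity). [folklore] -/
theorem line_sFam (u : ℚˣ) (j : toyIndex.Label) (vQ : toyIndex.VQ) (x : (scalarShells p U).Packet j vQ) :
    line j vQ (sFam p U u j vQ x) = (u : ℚ) ^ ((j : ℕ) + 1) * line j vQ x := by
  have h := line_factorwise_of_smul j vQ (fun _ => (scalarShells p U).summandwise vQ fun _ => mulEquiv (u : ℚ) u.ne_zero) (fun _ => (u : ℚ))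
    (fun _ y => by funext v; rfl) x
  rw [Finset.prod_const, Finset.card_univ, Fintype.card_fin] at h
  exact h

section Moving

variable [hp : Fact p.Prime]

/-- `sFam u` maps `B_k` at label `j` onto `B_{k + (j+1)·v_p(u)}`. [folklore] -/
theorem image_sBall_sFam (u : ℚˣ) (j : toyIndex.Label) (vQ : toyIndex.VQ) (k : ℤ) :
    sFam p U u j vQ '' sBall p U j vQ k = sBall p U j vQ (k + (((j : ℕ) + 1 : ℕ) : ℤ) * padicValRat p (u : ℚ)) := by
  rw [image_sBall_of_line_eq (sFam p U u j vQ) (pow_ne_zero _ u.ne_zero) (line_sFam p U u j vQ) k, padicValRat.pow (u : ℚ)]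

/-- The uniformiser `p` as a unit of `ℚ`. [folklore] -/
def pUnit : ℚˣ := Units.mk0 (p : ℚ) (by exact_mod_cast hp.out.ne_zero)

/-- `v_p(p) = 1`. [folklore] -/
theorem padicValRat_pUnit : padicValRat p ((pUnit p : ℚˣ) : ℚ) = 1 := by
  show padicValRat p (p : ℚ) = 1
  exact_mod_cast padicValRat.self hp.out.one_lt

/-- **NO BALL IS STABLE once `p ∈ U`**: the (Ind2)-family `sFam p` moves `B_k` at label `j` onto `B_{k+j+1} ≠ B_k`. [folklore] -/
theorem exists_ind2_moving_sBall (hpU : pUnit p ∈ U) (j : toyIndex.Label) (vQ : toyIndex.VQ) (k : ℤ) :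
    ∃ Φ ∈ (scalarShells p U).Ind2Family, Φ j vQ '' sBall p U j vQ k = sBall p U j vQ (k + ((j : ℕ) + 1 : ℕ)) ∧
      Φ j vQ '' sBall p U j vQ k ≠ sBall p U j vQ k := by
  refine ⟨sFam p U (pUnit p), sFam_mem_Ind2Family p U hpU, ?_, ?_⟩
  · rw [image_sBall_sFam, padicValRat_pUnit, mul_one]
  · rw [image_sBall_sFam, padicValRat_pUnit, mul_one]
    intro h
    have := sBall_injective p U j vQ h
    omega

/-- **Step (x) log-volume invariance FAILS for balls once `p ∈ U`**: the (Ind2)-family `sFam p` changes the log-volume of every ball at every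
label (by `−(j+1)·log p`). [folklore] -/
theorem sVol_image_sFam_pUnit (hpU : pUnit p ∈ U) (j : toyIndex.Label) (vQ : toyIndex.VQ) (k : ℤ) :
    sVol p U j vQ (sFam p U (pUnit p) j vQ '' sBall p U j vQ k) = sVol p U j vQ (sBall p U j vQ k) - (((j : ℕ) + 1 : ℕ) : ℝ) * Real.log p ∧
      sVol p U j vQ (sFam p U (pUnit p) j vQ '' sBall p U j vQ k) ≠ sVol p U j vQ (sBall p U j vQ k) := by
  have _ := hpU
  have hl := log_p_pos p
  rw [image_sBall_sFam, padicValRat_pUnit, mul_one, sVol_sBall, sVol_sBall]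
  constructor
  · push_cast; ring
  · intro h
    have h' : ((((j : ℕ) + 1 : ℕ) : ℤ) : ℝ) * Real.log p = 0 := by push_cast at h ⊢; linarith
    rcases mul_eq_zero.1 h' with h1 | h1
    · have : (0 : ℝ) < (((j : ℕ) + 1 : ℕ) : ℤ) := by exact_mod_cast Nat.succ_pos _
      linarith
    · exact hl.ne' h1

/-- **LABEL-BY-LABEL REACHABILITY**: for `p ∈ U`, at label `j` the (Ind2)-family `sFam (p^a)` maps `B_k` onto `B_{k + a·(j+1)}`; in particular
every ball `B_{k + a·(j+1)}` is an (Ind2)-image of `B_k` — Joshi-type rescalings realised INSIDE the indeterminacy group, with the scalar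
depending on the label (there is no single power of `p` sending `B_{j²}` to `B_1` at both labels of `𝔽_l^⋇`: `j + 1 ∤ 1 − j²` fails at
`j = 2`; per-label families are what (Ind2) provides). [folklore] -/
theorem image_sBall_sFam_zpow (hpU : pUnit p ∈ U) (a : ℤ) (j : toyIndex.Label) (vQ : toyIndex.VQ) (k : ℤ) :
    sFam p U (pUnit p ^ a) ∈ (scalarShells p U).Ind2Family ∧
      sFam p U (pUnit p ^ a) j vQ '' sBall p U j vQ k = sBall p U j vQ (k + (((j : ℕ) + 1 : ℕ) : ℤ) * a) := by
  refine ⟨sFam_mem_Ind2Family p U (U.zpow_mem hpU a), ?_⟩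
  rw [image_sBall_sFam, Units.val_zpow_eq_zpow_val, padicValRat.zpow ((pUnit p : ℚˣ) : ℚ), padicValRat_pUnit, mul_one]

end Moving

/-! ## 5. The three instances of record -/

/-- `U = ⊤`: the uniformiser is an indeterminacy of the SCALING shells. [folklore] -/
theorem pUnit_mem_top [Fact p.Prime] : pUnit p ∈ (⊤ : Subgroup ℚˣ) := Subgroup.mem_top _

/-- In the scaling shells NO `p`-adic ball is stable under `⟨(Ind1) ∪ (Ind2)⟩` (instance of `exists_ind2_moving_sBall`). [folklore] -/
theorem scaling_exists_moving_sBall [Fact p.Prime] (j : toyIndex.Label) (vQ : toyIndex.VQ) (k : ℤ) :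
    ∃ Φ ∈ Subgroup.closure ((scalingShells p).Ind1Family ∪ (scalingShells p).Ind2Family),
      Φ j vQ '' sBall p ⊤ j vQ k ≠ sBall p ⊤ j vQ k := by
  obtain ⟨Φ, hΦ, -, hne⟩ := exists_ind2_moving_sBall p ⊤ (pUnit_mem_top p) j vQ k
  exact ⟨Φ, Subgroup.subset_closure (Or.inr hΦ), hne⟩

/-- The sign group `{±1}` of abc-iut-w5-d247's `signShells` lies in EVERY scalar automorphism group containing `−1` (so the naive data's
sign indeterminacies remain indeterminacies of the scalar shells). [folklore] -/
theorem signs_subset_scalarAuts (hneg : (-1 : ℚˣ) ∈ U) : signs ⊆ scalarAuts U := by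
  rintro g (rfl | rfl)
  · exact refl_mem_scalarAuts U
  · exact ⟨-1, hneg, fun y => by simp [LinearEquiv.neg_apply]⟩

/-- A family of the sign shells acting by signs acts by scalars of any `U ∋ −1`. [folklore] -/
theorem actsByScalars_of_actsBySigns (hneg : (-1 : ℚˣ) ∈ U) {Φ : signShells.PacketAut} (h : ActsBySigns Φ) :
    ActsByScalars p U Φ := by
  refine ⟨fun j vQ => ?_⟩
  obtain ⟨ε, hε, hΦ⟩ := h.sign j vQ
  rcases (abs_eq (zero_le_one' ℚ)).1 hε with rfl | rfl
  · exact ⟨1, U.one_mem, fun x => by rw [Units.val_one]; exact hΦ x⟩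
  · exact ⟨-1, hneg, fun x => by rw [Units.val_neg, Units.val_one]; exact hΦ x⟩

/-- abc-iut-w4-d101's `p`-adic units embed: a unit `c` of `ℚ` with `v_p(c) = 0` gives an element of `ℚˣ`, and `padicUnits p ⊆ scalarAuts ⊤`.
[folklore] -/
theorem padicUnits_subset_scalarAuts_top : padicUnits p ⊆ scalarAuts (⊤ : Subgroup ℚˣ) := by
  rintro g ⟨c, hc, hg⟩
  exact ⟨Units.mk0 c hc.1, Subgroup.mem_top _, hg⟩

end Summit.ABC.IUTFork.Repair.ScalarShells

end
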